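import Mathlib.CategoryTheory.Action.Concrete
import Mathlib.CategoryTheory.InducedCategory
import Mathlib.GroupTheory.GroupAction.Quotient
import Mathlib.Tactic.Group
import HarnessLib

/-!
# The Π-avatar ambient category of [IUTchI] Def 4.1 (i) / Def 6.1 (ii) with EMBEDDED objects: the orbit category
# of ONE ambient group (KIT-INSTANCE-SPEC P5, design D1 ruled EMBEDDED by abc-iut-L5-lead RULINGS #17 (2))

S. Mochizuki, *Inter-universal Teichmüller theory I*, kurims manuscript (May 2020), §0 «Categories» pp. 33–35
(a connected anabelioid `ℬ(Π)⁰`; "isomorphisms of `ℬ(Π)⁰`-objects correspond to outer isomorphisms"), Def 4.1 (i)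
p. 95 ("`†𝒟_v` is a category which admits an equivalence `†𝒟_v ⥲ 𝒟_v`", where `𝒟_v = ℬ^temp(X̲_v)⁰` / `ℬ(X→_v)⁰`),
Def 6.1 (ii) p. 156 ("`π₁(†𝒟_v)` determines, in a functorial fashion, a … group corresponding to `X_v` … which
contains `π₁(†𝒟_v)` as an open subgroup"), (v) p. 158 (`𝒟^{⊚±} = ℬ(X_K)⁰`, `Aut_K(X_K) ⥲ Aut_±(𝒟^{⊚±})/Aut_csp ⥲ 𝔽_l^{⋊±}`)
([IUTchI] Def 4.1 (i) p.95) [claim: Mochizuki2012, status: disputed] (D-0012 claim key, series status DISPUTED —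
this file is GROUP-THEORETIC PLUMBING for the genuine kit instance; nothing of the series is asserted and no side
is taken on [IUTchIII] Cor. 3.12).

## Design (HOME/staging/L5/L5-t4/KIT-INSTANCE-SPEC.md P5; RULINGS #17 (2) D1 = EMBEDDED)

All the isomorphs `†𝒟_v`, `†𝒟_v^±`, `†𝒟^{⊚±}` that [IUTchI] §6 ever meets inside one Hodge theater are finite étale
(sub)covers of ONE curve, i.e. — in the Π-avatar — closed subgroups `H` of ONE ambient arithmetic fundamental
group `A` (for the genuine instance: `A := Π_{C_F}` = abc-iut-L5-t2's `InitialThetaData.geom.extF.arith`), the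
connected object `ℬ(H)⁰ ↪ ℬ(A)⁰` being the homogeneous `A`-set `A/H`.  A morphism `ℬ(H)⁰ → ℬ(K)⁰` OVER the
ambient is an `A`-equivariant map `A/H → A/K`; these are exactly the right multiplications `xH ↦ xaK` by elements
`a` with `a⁻¹Ha ≤ K` (`exists_eq_homOfElem`), isomorphisms = conjugations (`nonempty_iso_iff_conjugate`), and
`Aut(A/H) = N_A(H)/H` acting on the right (`autOfNormalizer`, `autOfNormalizer_eq_iff`).  With this choice
Def 6.1 (ii)'s `†𝒟_v ↦ †𝒟_v^±` becomes a DEFINITION (an intermediate subgroup, characteristic by [EtTh] Prop 2.4 /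
abc-iut-L5-t1 `CharacteristicNatureOfCoverings`) rather than a datum, and inner automorphisms of `A` are honest
morphisms (their triviality on cusp sets is KIT-INSTANCE-SPEC P1).

* `orbitAction A H` — `A/H` as an object of Mathlib's `Action (Type u) A`; `OrbitCat A` — the induced (full
  sub)category on the objects `A/H`, `H : Subgroup A` (NO instance is declared here: the category structure is
  Mathlib's `InducedCategory.category`); `OrbitCat.of` / `OrbitCat.sub`.
* `OrbitCat.homOfElem a h : of H ⟶ of K` for `MulAut.conj a⁻¹ • H ≤ K` (`xH ↦ xaK`), `fn_homOfElem`,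
  `exists_eq_homOfElem` (every morphism is one), `isoOfConj`, `nonempty_iso_iff_conjugate`.
* `OrbitCat.autOfNormalizer : (H.normalizer)ᵐᵒᵖ-elements ↦ (of H ≅ of H)`, `autOfNormalizer_eq_iff`
  (two normaliser elements give the same automorphism iff they differ by `H`).

Pure Mathlib plumbing (Action, InducedCategory, quotient actions); universe: `A : Type u` gives `OrbitCat A : Type u`
with `Category.{u}` — the shape abc-iut-L5-t4's `PMBaseKit.{u}` wants for `Amb v`.  typed ≠ proved elsewhere.
-/

namespace Literature.IUT.HodgeTheaters

open CategoryTheory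

universe u

variable (A : Type u) [Group A]

/-- `A/H` with its left `A`-action, as an object of the category of `A`-sets ([IUTchI] §0 p.33: the connected object
`ℬ(H)⁰ ↪ ℬ(A)⁰` in the Π-avatar). ([IUTchI] Def 4.1 (i) p.95) [claim: Mochizuki2012, status: disputed] -/
abbrev orbitAction (H : Subgroup A) : Action (Type u) A := Action.ofMulAction A (A ⧸ H)

/-- **The orbit category of `A`** — the Π-avatar ambient category with EMBEDDED objects: objects = subgroups `H ≤ A`
(read: `ℬ(H)⁰` embedded in `ℬ(A)⁰`), morphisms = `A`-equivariant maps `A/H → A/K` (the full subcategory of `A`-sets on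
the homogeneous spaces; Mathlib's induced category — no instance declared here).
([IUTchI] Def 4.1 (i) p.95) [claim: Mochizuki2012, status: disputed] -/
abbrev OrbitCat : Type u := InducedCategory (Action (Type u) A) (orbitAction A)

namespace OrbitCat

variable {A}

/-- The object `ℬ(H)⁰` / `A/H` of a subgroup. ([IUTchI] Def 4.1 (i) p.95) [claim: Mochizuki2012, status: disputed] -/
def of (H : Subgroup A) : OrbitCat A := H

/-- The subgroup of an object. ([IUTchI] Def 4.1 (i) p.95) [claim: Mochizuki2012, status: disputed] -/
def sub (X : OrbitCat A) : Subgroup A := X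

/-- `sub (of H) = H`. ([IUTchI] Def 4.1 (i) p.95) [claim: Mochizuki2012, status: disputed] -/
@[simp] theorem sub_of (H : Subgroup A) : (of H).sub = H := rfl

/-- `of (sub X) = X`. ([IUTchI] Def 4.1 (i) p.95) [claim: Mochizuki2012, status: disputed] -/
@[simp] theorem of_sub (X : OrbitCat A) : of X.sub = X := rfl

/-- The underlying map `A/H → A/K` of a morphism. ([IUTchI] §0 p.33) [claim: Mochizuki2012, status: disputed] -/
def fn {X Y : OrbitCat A} (f : X ⟶ Y) : A ⧸ X.sub → A ⧸ Y.sub := fun q => f.hom.hom q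

/-- Morphisms are `A`-equivariant. ([IUTchI] §0 p.33) [claim: Mochizuki2012, status: disputed] -/
theorem fn_smul {X Y : OrbitCat A} (f : X ⟶ Y) (a : A) (q : A ⧸ X.sub) : fn f (a • q) = a • fn f q := by
  have h := ConcreteCategory.congr_hom (f.hom.comm a) q
  simp only [types_comp_apply, Action.ofMulAction_apply] at h
  exact h

/-- Two morphisms with the same underlying map are equal. ([IUTchI] §0 p.33) [claim: Mochizuki2012, status: disputed] -/
theorem hom_ext_fn {X Y : OrbitCat A} {f g : X ⟶ Y} (h : fn f = fn g) : f = g := by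
  apply InducedCategory.hom_ext
  apply Action.hom_ext
  exact ConcreteCategory.hom_ext _ _ (fun q => congrFun h q)

/-- `fn` of the identity. ([IUTchI] §0 p.33) [claim: Mochizuki2012, status: disputed] -/
@[simp] theorem fn_id (X : OrbitCat A) : fn (𝟙 X) = id := rfl

/-- `fn` of a composite. ([IUTchI] §0 p.33) [claim: Mochizuki2012, status: disputed] -/
@[simp] theorem fn_comp {X Y Z : OrbitCat A} (f : X ⟶ Y) (g : Y ⟶ Z) : fn (f ≫ g) = fn g ∘ fn f := rfl

/-- Constructor of morphisms from equivariant maps. ([IUTchI] §0 p.33) [claim: Mochizuki2012, status: disputed] -/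
def homMk {X Y : OrbitCat A} (g : A ⧸ X.sub → A ⧸ Y.sub) (hg : ∀ (a : A) (q : A ⧸ X.sub), g (a • q) = a • g q) :
    X ⟶ Y :=
  InducedCategory.homMk
    { hom := TypeCat.ofHom g
      comm := fun a => ConcreteCategory.hom_ext _ _ fun q => by
        simp only [types_comp_apply, TypeCat.ofHom_apply, Action.ofMulAction_apply]
        exact hg a q }

/-- `fn (homMk g _) = g`. ([IUTchI] §0 p.33) [claim: Mochizuki2012, status: disputed] -/
@[simp] theorem fn_homMk {X Y : OrbitCat A} (g : A ⧸ X.sub → A ⧸ Y.sub) (hg) : fn (homMk g hg) = g := rfl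

/-! ### Morphisms are right multiplications by elements conjugating `H` into `K` -/

/-- **The morphism `xH ↦ xaK`** for an element `a ∈ A` with `a⁻¹Ha ≤ K` — in `ℬ(A)⁰`: the morphism of connected
objects `ℬ(H)⁰ → ℬ(K)⁰` induced by the inclusion `a⁻¹Ha ⊆ K` composed with the inner automorphism; print's
"open injective homomorphism up to composition with an inner automorphism" ([IUTchI] §0 p.33).
([IUTchI] Def 4.1 (i) p.95) [claim: Mochizuki2012, status: disputed] -/
def homOfElem {H K : Subgroup A} (a : A) (h : ∀ x ∈ H, a⁻¹ * x * a ∈ K) : (of H : OrbitCat A) ⟶ of K :=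
  homMk (Quotient.map' (· * a) fun x y hxy => by
      rw [QuotientGroup.leftRel_apply] at hxy ⊢
      have e : (x * a)⁻¹ * (y * a) = a⁻¹ * (x⁻¹ * y) * a := by group
      rw [e]
      exact h _ hxy)
    fun b q => Quotient.inductionOn' q fun x => by
      change (QuotientGroup.mk (b * x * a) : A ⧸ K) = b • (QuotientGroup.mk (x * a) : A ⧸ K)
      rw [MulAction.Quotient.smul_mk, smul_eq_mul, mul_assoc]

/-- `homOfElem a` is `xH ↦ xaK`. ([IUTchI] Def 4.1 (i) p.95) [claim: Mochizuki2012, status: disputed] -/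
@[simp] theorem fn_homOfElem {H K : Subgroup A} (a : A) (h : ∀ x ∈ H, a⁻¹ * x * a ∈ K) (x : A) :
    fn (homOfElem a h) (QuotientGroup.mk x) = QuotientGroup.mk (x * a) := rfl

/-- **Every morphism `A/H → A/K` is `xH ↦ xaK`** for some `a` with `a⁻¹Ha ≤ K` (evaluate at the coset of `1`):
morphisms of embedded connected objects are the printed "outer" ones realised inside the ambient.
([IUTchI] Def 4.1 (i) p.95) [claim: Mochizuki2012, status: disputed] -/
theorem exists_eq_homOfElem {H K : Subgroup A} (f : (of H : OrbitCat A) ⟶ of K) :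
    ∃ (a : A) (h : ∀ x ∈ H, a⁻¹ * x * a ∈ K), f = homOfElem a h := by
  obtain ⟨a, ha⟩ := Quotient.exists_rep (fn f (QuotientGroup.mk 1))
  have key : ∀ x : A, fn f (QuotientGroup.mk x) = QuotientGroup.mk (x * a) := by
    intro x
    have := fn_smul f x (QuotientGroup.mk 1)
    rw [MulAction.Quotient.smul_mk, smul_eq_mul, mul_one] at this
    rw [this, ← ha]
    rfl
  have hH : ∀ x ∈ H, a⁻¹ * x * a ∈ K := by
    intro x hx
    have hx1 : (QuotientGroup.mk x⁻¹ : A ⧸ (of H).sub) = QuotientGroup.mk 1 :=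
      QuotientGroup.eq.mpr (by rw [inv_inv, mul_one]; exact hx)
    have h1 := congrArg (fn f) hx1
    rw [key, key, one_mul] at h1
    have h2 : (x⁻¹ * a)⁻¹ * a ∈ K := QuotientGroup.eq.mp h1
    simpa [mul_inv_rev, mul_assoc] using h2
  refine ⟨a, hH, hom_ext_fn (funext fun q => Quotient.inductionOn' q fun x => ?_)⟩
  exact key x

/-- **Conjugate subgroups give isomorphic objects**: for `K = a⁻¹Ha` the morphisms `xH ↦ xaK`, `yK ↦ ya⁻¹H` are
inverse ([IUTchI] Def 4.1 (i): the isomorphs `†𝒟_v` of `𝒟_v`, embedded, are the conjugates).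
([IUTchI] Def 4.1 (i) p.95) [claim: Mochizuki2012, status: disputed] -/
def isoOfConj {H K : Subgroup A} (a : A) (h : ∀ x, x ∈ K ↔ a * x * a⁻¹ ∈ H) : (of H : OrbitCat A) ≅ of K where
  hom := homOfElem a fun x hx => (h _).2 (by simpa [mul_assoc] using hx)
  inv := homOfElem a⁻¹ fun x hx => by simpa using (h x).1 hx
  hom_inv_id := hom_ext_fn (funext fun q => Quotient.inductionOn' q fun x => by
    change fn (homOfElem a _ ≫ homOfElem a⁻¹ _) (QuotientGroup.mk x) = QuotientGroup.mk x
    rw [fn_comp, Function.comp_apply, fn_homOfElem, fn_homOfElem, mul_inv_cancel_right])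
  inv_hom_id := hom_ext_fn (funext fun q => Quotient.inductionOn' q fun x => by
    change fn (homOfElem a⁻¹ _ ≫ homOfElem a _) (QuotientGroup.mk x) = QuotientGroup.mk x
    rw [fn_comp, Function.comp_apply, fn_homOfElem, fn_homOfElem, inv_mul_cancel_right])

/-- **Isomorphs = conjugates**: two embedded connected objects `A/H`, `A/K` are isomorphic over the ambient iff
`K = a⁻¹Ha` for some `a ∈ A` ([IUTchI] Def 4.1 (i) "a category which admits an equivalence `†𝒟_v ⥲ 𝒟_v`", read in
the Π-avatar with embedded objects). ([IUTchI] Def 4.1 (i) p.95) [claim: Mochizuki2012, status: disputed] -/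
theorem nonempty_iso_iff_conjugate (H K : Subgroup A) :
    Nonempty ((of H : OrbitCat A) ≅ of K) ↔ ∃ a : A, ∀ x, x ∈ K ↔ a * x * a⁻¹ ∈ H := by
  constructor
  · rintro ⟨e⟩
    obtain ⟨a, ha, hea⟩ := exists_eq_homOfElem e.hom
    obtain ⟨b, hb, heb⟩ := exists_eq_homOfElem e.inv
    -- `ab ∈ H` from `hom ≫ inv = 𝟙` evaluated at `1·H`
    have hab : a * b ∈ H := by
      have h1 := congrArg (fun φ => fn φ (QuotientGroup.mk (1 : A))) e.hom_inv_id
      simp only [fn_comp, Function.comp_apply, fn_id, id_eq, hea, heb, fn_homOfElem, one_mul] at h1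
      have h2 := QuotientGroup.eq.mp h1
      simpa using H.inv_mem h2
    refine ⟨a, fun x => ⟨fun hx => ?_, fun hx => ?_⟩⟩
    · -- `x ∈ K ⇒ b⁻¹ x b ∈ H ⇒ a x a⁻¹ = (ab)(b⁻¹ x b)(ab)⁻¹ ∈ H`
      have h3 := hb x hx
      have h4 : a * x * a⁻¹ = (a * b) * (b⁻¹ * x * b) * (a * b)⁻¹ := by group
      rw [h4]
      exact H.mul_mem (H.mul_mem hab h3) (H.inv_mem hab)
    · simpa [mul_assoc] using ha _ hx
  · rintro ⟨a, ha⟩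
    exact ⟨isoOfConj a ha⟩

/-! ### Automorphisms: the normaliser acting on the right -/

/-- The automorphism `xH ↦ xnH` of `A/H` for `n` in the normaliser of `H` ([IUTchI] Def 6.1 (v) p.158: e.g.
`Aut_K(X_K) = N(Π_{X_K})/Π_{X_K}` inside `Π_{C_K}` acting on `ℬ(X_K)⁰`). ([IUTchI] Def 6.1 (v) p.158) [claim: Mochizuki2012, status: disputed] -/
def autOfNormalizer {H : Subgroup A} (n : A) (hn : n ∈ Subgroup.normalizer (H : Set A)) : (of H : OrbitCat A) ≅ of H :=
  isoOfConj n fun x => by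
    rw [Subgroup.mem_normalizer_iff] at hn
    exact hn x

/-- `autOfNormalizer n` is `xH ↦ xnH`. ([IUTchI] Def 6.1 (v) p.158) [claim: Mochizuki2012, status: disputed] -/
@[simp] theorem fn_autOfNormalizer_hom {H : Subgroup A} (n : A) (hn : n ∈ Subgroup.normalizer (H : Set A)) (x : A) :
    fn (autOfNormalizer n hn).hom (QuotientGroup.mk x) = QuotientGroup.mk (x * n) := rfl

/-- Two normalising elements induce the SAME automorphism iff they agree modulo `H` — i.e. `Aut(A/H) = N_A(H)/H`
(with `exists_eq_homOfElem`: every automorphism comes from the normaliser).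
([IUTchI] Def 6.1 (v) p.158) [claim: Mochizuki2012, status: disputed] -/
theorem autOfNormalizer_eq_iff {H : Subgroup A} {n m : A} (hn : n ∈ Subgroup.normalizer (H : Set A)) (hm : m ∈ Subgroup.normalizer (H : Set A)) :
    autOfNormalizer n hn = autOfNormalizer m hm ↔ n⁻¹ * m ∈ H := by
  constructor
  · intro h
    have h1 := congrArg (fun e : (of H : OrbitCat A) ≅ of H => fn e.hom (QuotientGroup.mk (1 : A))) h
    simp only [fn_autOfNormalizer_hom, one_mul] at h1
    exact QuotientGroup.eq.mp h1
  · intro h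
    ext : 1
    apply hom_ext_fn
    funext q
    induction q using Quotient.inductionOn' with
    | h x =>
      change QuotientGroup.mk (x * n) = (QuotientGroup.mk (x * m) : A ⧸ H)
      rw [QuotientGroup.eq]
      simpa [mul_assoc] using h

/-- Every automorphism of `A/H` comes from the normaliser. ([IUTchI] Def 6.1 (v) p.158) [claim: Mochizuki2012, status: disputed] -/
theorem exists_eq_autOfNormalizer {H : Subgroup A} (e : (of H : OrbitCat A) ≅ of H) :
    ∃ (n : A) (hn : n ∈ Subgroup.normalizer (H : Set A)), e = autOfNormalizer n hn := by
  obtain ⟨a, ha, hea⟩ := exists_eq_homOfElem e.hom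
  -- the element `a` of `e.hom` normalises `H`: `a⁻¹Ha ≤ H` and, from the inverse, equality
  obtain ⟨b, hb, heb⟩ := exists_eq_homOfElem e.inv
  have hab : a * b ∈ H := by
    have h1 := congrArg (fun φ => fn φ (QuotientGroup.mk (1 : A))) e.hom_inv_id
    simp only [fn_comp, Function.comp_apply, fn_id, id_eq, hea, heb, fn_homOfElem, one_mul] at h1
    simpa using H.inv_mem (QuotientGroup.eq.mp h1)
  have hn : a ∈ Subgroup.normalizer (H : Set A) := by
    rw [Subgroup.mem_normalizer_iff]
    intro x
    constructor
    · intro hx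
      -- `a x a⁻¹ = (ab) (b⁻¹ x b) (ab)⁻¹`
      have h4 : a * x * a⁻¹ = (a * b) * (b⁻¹ * x * b) * (a * b)⁻¹ := by group
      rw [h4]
      exact H.mul_mem (H.mul_mem hab (hb x hx)) (H.inv_mem hab)
    · intro hx
      simpa [mul_assoc] using ha _ hx
  refine ⟨a, hn, ?_⟩
  ext : 1
  exact hea

end OrbitCat

end Literature.IUT.HodgeTheaters
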